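import Literature.AnabelianGeometry.AbsoluteAnabelian.GaloisCyclotomeRestriction
import Literature.AnabelianGeometry.AbsoluteAnabelian.GaloisCyclotomeTower
import Literature.AnabelianGeometry.AbsoluteAnabelian.LocalResidueMapRestrictionIndex
import HarnessLib

/-!
# [AbsTopIII] Rmk. 1.10.1 (iii): the index formula for `H²(G_k, μ_Ẑ(G_k)) ⥲ Ẑ` under restriction

S. Mochizuki, *Topics in Absolute Anabelian Geometry III* (2015), Rmk. 1.10.1 (iii) p. 44: the
functoriality of the isomorphism `H²(G_k, μ_Ẑ(G_k)) ⥲ Ẑ` of Cor. 1.10 (i)(a) in open injections of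
profinite groups «is to be understood in the sense of a compatibility relative to dividing the `Ẑ` … by
a factor given by the index of the image of the induced open homomorphism».  abc-iut cell, layer L4
(L4-lead RULING #6c «GO (O4)», part 2; seat abc-iut-w5-d201).

For a finite extension `k′/k` of MLFs (characteristic `0`, valued form, each field with its own local
structure) and a `G_k`-equivariant identification `φ : μ_{ℚ/ℤ}(G_k) ≅ μ(k̄)` ([AbsAnab] Prop. 1.2.1 (vi);
F-0018 `MLFGaloisCyclotomeIsRootsOfUnity`, PROVED) — the datum through which abc-iut-L4-t17 presents
`μ_Ẑ(G_k)` as the tower `lim_i μ_{(i+1)!}(k̄)` (`galCyclotomeTower φ hφ`) and computes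
`H²(G_k, μ_Ẑ(G_k)) = lim_i H²(G_k, μ_{(i+1)!})` (`DiscreteTowerPresentation.toLimitClasses`, NSW (2.7.5)):

* `inducedCyclotomeEquiv k k′ φ : μ_{ℚ/ℤ}(G_{k′}) ≅ μ(k̄′)` — the identification for `k′` INDUCED from `φ`
  along `μ_{ℚ/ℤ}(res)` (`muQZ.mapOfOpenEmbedding`, abc-iut-L4-t17) and `ι : k̄ ≅ k̄′` (the
  restriction-compatible member of the family «reconstructed group-theoretically by considering the
  Verlagerung», [AbsAnab] p. 11); `inducedCyclotomeEquiv_smul` — it is `G_{k′}`-equivariant;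
* `cycProj_galCyclotomeResCoeff` — the coefficient morphism `μ_Ẑ(G_k)|_{G_{k′}} → μ_Ẑ(G_{k′})` of
  `GaloisCyclotomeRestriction.lean` intertwines the tower projections with `ι|μ_n`
  (`Prop121vii.muRes`); `cohomologyMap_cycProj_galCyclotomeRes` — hence
  **`Res : H²(G_k, μ_Ẑ(G_k)) → H²(G_{k′}, μ_Ẑ(G_{k′}))` is, level by level, `Res : H²(G_k, μ_n) →
  H²(G_{k′}, μ_n)`** (`Prop121vii.resMu`);
* **`invLevel_toLimitClasses_galCyclotomeRes`** — the index formula in components: for every `i`,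
  `inv_{k′,(i+1)!}((Res x)_i) = [k′ : k] · inv_{k,(i+1)!}(x_i)` in `ℤ/(i+1)!`, THE residue maps
  `Prop121vii.invLevel` (abc-iut-w5-d198/d201/d214) on both sides — from
  `Prop121vii.invLevel_resMu` (`LocalResidueMapRestrictionIndex.lean`, Serre XIII §3 Prop. 7).

SCOPE (honest): the statement is about the identification of `μ_{ℚ/ℤ}(G_{k′})` INDUCED from `φ`; that the
identification furnished independently for `k′` by F-0018 (an `∃`) agrees with it is the naturality of
local reciprocity under restriction and is not asserted here (two equivariant identifications differ by
a unit of `Ẑ`, which would rescale `inv_{k′}`).  Constructions + proofs; no named fact; nothing here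
bears on [IUTchIII] Cor. 3.12 or takes a side.
-/

noncomputable section

open scoped Pointwise
open Topology CategoryTheory

universe u

namespace Literature.AnabelianGeometry.AbsoluteAnabelian

open Field Function CategoryTheory
open Literature.NumberTheory.GaloisRepresentations
open Literature.NumberTheory.GaloisRepresentations.DiscreteGaloisModule
open Literature.NumberTheory.GaloisRepresentations.LocalWeilDatum

section Induced

variable (k k' : Type u) [Field k] [CharZero k] [Field k'] [CharZero k'] [Algebra k k'] [FiniteDimensional k k']
  (φ : muQZ (absoluteGaloisGroup k) ≃+ Additive (CommGroup.torsion (AlgebraicClosure k)ˣ))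
  (hφ : ∀ (σ : absoluteGaloisGroup k) (x : muQZ (absoluteGaloisGroup k)),
    (((Additive.toMul (φ (σ • x)) : CommGroup.torsion (AlgebraicClosure k)ˣ) :
        (AlgebraicClosure k)ˣ) : AlgebraicClosure k) =
      σ • (((Additive.toMul (φ x) : CommGroup.torsion (AlgebraicClosure k)ˣ) :
        (AlgebraicClosure k)ˣ) : AlgebraicClosure k))

/-- Transport of torsion units `μ(k̄) ≅ μ(k̄′)` along `ι : k̄ ≅ k̄′` (additive notation).
[cite: MochizukiAbsTopIII2015, Cor 1.10 (i) p.42] -/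
def torsionUnitsTransport :
    Additive (CommGroup.torsion (AlgebraicClosure k)ˣ) ≃+ Additive (CommGroup.torsion (AlgebraicClosure k')ˣ) :=
  MulEquiv.toAdditive (torsionCongr (Units.mapEquiv (absClosureEquiv k k').toMulEquiv))

omit [CharZero k'] in
/-- Underlying formula for `torsionUnitsTransport`: `ι` on the unit. [cite: MochizukiAbsTopIII2015, Cor 1.10 (i) p.42] -/
@[simp] theorem coe_toMul_torsionUnitsTransport (x : Additive (CommGroup.torsion (AlgebraicClosure k)ˣ)) :
    ((((Additive.toMul (torsionUnitsTransport k k' x)) : CommGroup.torsion (AlgebraicClosure k')ˣ) :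
        (AlgebraicClosure k')ˣ) : AlgebraicClosure k') =
      absClosureEmbedding k k' (((Additive.toMul x : CommGroup.torsion (AlgebraicClosure k)ˣ) :
        (AlgebraicClosure k)ˣ) : AlgebraicClosure k) := rfl

/-- **The identification `μ_{ℚ/ℤ}(G_{k′}) ≅ μ(k̄′)` INDUCED from `φ : μ_{ℚ/ℤ}(G_k) ≅ μ(k̄)`** along the
open embedding `res : G_{k′} ↪ G_k` (`muQZ.mapOfOpenEmbedding`) and `ι : k̄ ≅ k̄′` — the
restriction-compatible member of the family of identifications («by considering the Verlagerung»,
[AbsAnab] p. 11). [cite: MochizukiAbsTopIII2015, Cor 1.10 (i) p.42] -/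
def inducedCyclotomeEquiv :
    muQZ (absoluteGaloisGroup k') ≃+ Additive (CommGroup.torsion (AlgebraicClosure k')ˣ) :=
  ((muQZ.mapOfOpenEmbedding (absGaloisRestrict k k') (absGaloisRestrict_injective k k')
      (isOpen_range_absGaloisRestrict k k')).trans φ).trans (torsionUnitsTransport k k')

/-- Formula for the induced identification. [cite: MochizukiAbsTopIII2015, Cor 1.10 (i) p.42] -/
theorem inducedCyclotomeEquiv_apply (x : muQZ (absoluteGaloisGroup k')) :
    inducedCyclotomeEquiv k k' φ x =
      torsionUnitsTransport k k' (φ (muQZ.mapOfOpenEmbedding (absGaloisRestrict k k')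
        (absGaloisRestrict_injective k k') (isOpen_range_absGaloisRestrict k k') x)) := rfl

include hφ in
/-- **The induced identification is `G_{k′}`-equivariant** (equivariance of `μ_{ℚ/ℤ}(res)`, of `φ`, and of `ι`).
[cite: MochizukiAbsTopIII2015, Cor 1.10 (i) p.42] -/
theorem inducedCyclotomeEquiv_smul (σ : absoluteGaloisGroup k') (x : muQZ (absoluteGaloisGroup k')) :
    (((Additive.toMul (inducedCyclotomeEquiv k k' φ (σ • x)) : CommGroup.torsion (AlgebraicClosure k')ˣ) :
        (AlgebraicClosure k')ˣ) : AlgebraicClosure k') =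
      σ • (((Additive.toMul (inducedCyclotomeEquiv k k' φ x) : CommGroup.torsion (AlgebraicClosure k')ˣ) :
        (AlgebraicClosure k')ˣ) : AlgebraicClosure k') := by
  rw [inducedCyclotomeEquiv_apply, inducedCyclotomeEquiv_apply, coe_toMul_torsionUnitsTransport,
    coe_toMul_torsionUnitsTransport, muQZ.mapOfOpenEmbedding_smul, hφ, absGaloisRestrict_apply_smul]

/-- Components of the coefficient morphism `μ_Ẑ(G_k)|_{G_{k′}} → μ_Ẑ(G_{k′})`: the inverse of
`μ_{ℚ/ℤ}(res)` componentwise. [cite: MochizukiAbsTopIII2015, Remark 1.10.1 p.44] -/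
theorem toAdd_coe_galCyclotomeResCoeff_apply (z : MuZhatMod (absoluteGaloisGroup k)) (n : ℕ+) :
    Multiplicative.toAdd ((((galCyclotomeResCoeff k k').hom z).toMuZhat : ℕ+ →
        Multiplicative (muQZ (absoluteGaloisGroup k'))) n) =
      (muQZ.mapOfOpenEmbedding (absGaloisRestrict k k') (absGaloisRestrict_injective k k')
        (isOpen_range_absGaloisRestrict k k')).symm
        (Multiplicative.toAdd ((z.toMuZhat : ℕ+ → Multiplicative (muQZ (absoluteGaloisGroup k))) n)) := by
  rw [galCyclotomeResCoeff_hom_apply]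
  set f := absGaloisRestrict k k'
  set hinj := absGaloisRestrict_injective k k'
  set hf := isOpen_range_absGaloisRestrict k k'
  change Multiplicative.toAdd (((((muZhat.mapOfOpenEmbedding f hinj hf).symm z.toMuZhat) : muZhat _) :
      ℕ+ → Multiplicative (muQZ (absoluteGaloisGroup k'))) n) = _
  apply (muQZ.mapOfOpenEmbedding f hinj hf).injective
  rw [AddEquiv.apply_symm_apply]
  have h := congrArg (fun ξ : muZhat (absoluteGaloisGroup k) =>
      Multiplicative.toAdd ((ξ : ℕ+ → Multiplicative (muQZ (absoluteGaloisGroup k))) n))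
    ((muZhat.mapOfOpenEmbedding f hinj hf).apply_symm_apply z.toMuZhat)
  simp only [muZhat.coe_mapOfOpenEmbedding_apply, toAdd_ofAdd] at h
  exact h

include hφ in
/-- **Compatibility of the coefficient morphism with the tower projections**: for the induced
identification, `cycProj φ′ n ∘ (μ_Ẑ(G_k) → μ_Ẑ(G_{k′})) = ι|μ_n ∘ cycProj φ n`.
[cite: MochizukiAbsTopIII2015, Remark 1.10.1 p.44] -/
theorem cycProj_galCyclotomeResCoeff (n : ℕ+) (z : MuZhatMod (absoluteGaloisGroup k)) :
    (cycProj (inducedCyclotomeEquiv k k' φ) (inducedCyclotomeEquiv_smul k k' φ hφ) n).hom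
        ((galCyclotomeResCoeff k k').hom z) =
      Prop121vii.muRes k k' n ((cycProj φ hφ n).hom z) := by
  apply muVal_injective k' n
  refine Units.ext ?_
  rw [muVal_cycProj_hom, Prop121vii.coe_muVal_muRes, muVal_cycProj_hom]
  change ((((Additive.toMul (inducedCyclotomeEquiv k k' φ (Multiplicative.toAdd
      ((((galCyclotomeResCoeff k k').hom z).toMuZhat : ℕ+ → Multiplicative (muQZ (absoluteGaloisGroup k'))) n)))) :
        CommGroup.torsion (AlgebraicClosure k')ˣ) : (AlgebraicClosure k')ˣ) : AlgebraicClosure k') =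
    absClosureEmbedding k k' ((((Additive.toMul (φ (Multiplicative.toAdd
      ((z.toMuZhat : ℕ+ → Multiplicative (muQZ (absoluteGaloisGroup k))) n)))) :
        CommGroup.torsion (AlgebraicClosure k)ˣ) : (AlgebraicClosure k)ˣ) : AlgebraicClosure k)
  rw [toAdd_coe_galCyclotomeResCoeff_apply, inducedCyclotomeEquiv_apply, AddEquiv.apply_symm_apply,
    coe_toMul_torsionUnitsTransport]

include hφ in
/-- **`Res` on `H²(·, μ_Ẑ(·))` is `Res` on `H²(·, μ_n)` levelwise**: the tower projections intertwine
`galCyclotomeRes` with `Prop121vii.resMu`. [cite: MochizukiAbsTopIII2015, Remark 1.10.1 p.44] -/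
theorem cohomologyMap_cycProj_galCyclotomeRes (n : ℕ+)
    (x : continuousCohomology 2 (galCyclotomeTopRep (absoluteGaloisGroup k))) :
    (cohomologyMap (cycProj (inducedCyclotomeEquiv k k' φ) (inducedCyclotomeEquiv_smul k k' φ hφ) n) 2).hom
        ((galCyclotomeRes k k' 2).hom x) =
      Prop121vii.resMu k k' n 2 ((cohomologyMap (cycProj φ hφ n) 2).hom x) := by
  obtain ⟨c, rfl⟩ := twoCocycleClass_surjective _ x
  rw [cohomologyMap_hom_twoCocycleClass, Prop121vii.resMu_apply, map_twoCocycleClass]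
  change (cohomologyMap _ 2).hom (ContinuousCohomology.map (absGaloisRestrict k k') (galCyclotomeResCoeff k k') 2
    (twoCocycleClass _ c)) = _
  rw [map_twoCocycleClass, cohomologyMap_hom_twoCocycleClass]
  refine congrArg (twoCocycleClass _) (Subtype.ext (ContinuousMap.ext fun p => ?_))
  obtain ⟨σ, τ⟩ := p
  rw [contTwoCocycles.push_apply, contTwoCocycles.pullback_apply, contTwoCocycles.pullback_apply,
    contTwoCocycles.push_apply, Prop121vii.resCoeff_hom_apply]
  exact cycProj_galCyclotomeResCoeff k k' φ hφ n _

end Induced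

section Index

variable (k k' : Type u) [Field k] [ValuativeRel k] [TopologicalSpace k] [IsNonarchimedeanLocalField k]
  [CharZero k] [Field k'] [ValuativeRel k'] [TopologicalSpace k'] [IsNonarchimedeanLocalField k']
  [CharZero k'] [Algebra k k'] [FiniteDimensional k k']
  (φ : muQZ (absoluteGaloisGroup k) ≃+ Additive (CommGroup.torsion (AlgebraicClosure k)ˣ))
  (hφ : ∀ (σ : absoluteGaloisGroup k) (x : muQZ (absoluteGaloisGroup k)),
    (((Additive.toMul (φ (σ • x)) : CommGroup.torsion (AlgebraicClosure k)ˣ) :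
        (AlgebraicClosure k)ˣ) : AlgebraicClosure k) =
      σ • (((Additive.toMul (φ x) : CommGroup.torsion (AlgebraicClosure k)ˣ) :
        (AlgebraicClosure k)ˣ) : AlgebraicClosure k))

/-- **[AbsTopIII] Rmk. 1.10.1 (iii), the index formula for `H²(G_k, μ_Ẑ(G_k)) ⥲ Ẑ` in components**: reading
`H²(G, μ_Ẑ(G))` through its tower `lim_i H²(G, μ_{(i+1)!})` (`galCyclotomeTower`, abc-iut-L4-t17; NSW
(2.7.5)) and the levels through THE residue maps `inv_n` (`Prop121vii.invLevel`), the restriction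
`Res : H²(G_k, μ_Ẑ(G_k)) → H²(G_{k′}, μ_Ẑ(G_{k′}))` multiplies every component by the index `[k′ : k]`:
`inv_{k′,(i+1)!}((Res x)_i) = [k′ : k] · inv_{k,(i+1)!}(x_i)` — for the restriction-compatible
identification `μ_{ℚ/ℤ}(G_{k′}) ≅ μ(k̄′)` induced from `φ`. «the functoriality … is to be understood in the
sense of a compatibility relative to dividing the Ẑ … by a factor given by the index».
[cite: MochizukiAbsTopIII2015, Remark 1.10.1 p.44] -/
theorem invLevel_toLimitClasses_galCyclotomeRes (i : ℕ)
    (x : continuousCohomology 2 (galCyclotomeTopRep (absoluteGaloisGroup k))) :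
    Prop121vii.invLevel k' (cycLevel i : ℕ)
        (((galCyclotomeTower (inducedCyclotomeEquiv k k' φ) (inducedCyclotomeEquiv_smul k k' φ hφ)).toLimitClasses
          ((galCyclotomeRes k k' 2).hom x) : ∀ j, continuousCohomology 2
            ((galCyclotomeTower (k := k') (inducedCyclotomeEquiv k k' φ) (inducedCyclotomeEquiv_smul k k' φ hφ)).obj j)) i) =
      (Module.finrank k k' : ZMod (cycLevel i : ℕ)) *
        Prop121vii.invLevel k (cycLevel i : ℕ)
          (((galCyclotomeTower φ hφ).toLimitClasses x : ∀ j, continuousCohomology 2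
            ((galCyclotomeTower φ hφ).obj j)) i) := by
  rw [DiscreteTowerPresentation.toLimitClasses_apply_coe, DiscreteTowerPresentation.toLimitClasses_apply_coe]
  change Prop121vii.invLevel k' (cycLevel i : ℕ)
      ((cohomologyMap (cycProj (inducedCyclotomeEquiv k k' φ) (inducedCyclotomeEquiv_smul k k' φ hφ)
        (cycLevel i)) 2).hom ((galCyclotomeRes k k' 2).hom x)) =
    (Module.finrank k k' : ZMod (cycLevel i : ℕ)) *
      Prop121vii.invLevel k (cycLevel i : ℕ) ((cohomologyMap (cycProj φ hφ (cycLevel i)) 2).hom x)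
  rw [cohomologyMap_cycProj_galCyclotomeRes]
  exact Prop121vii.invLevel_resMu k k' (cycLevel i : ℕ) _

end Index

end Literature.AnabelianGeometry.AbsoluteAnabelian

end
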